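import Summits.QuantumFields.YangMills.Theses.LangevinControlUV

/-!
# `LangevinControlUV.Assembly` — the assembly item of route `LangevinControlUV`

Route `LangevinControlUV` (sub-problem `YangMills` of summit `QuantumFields`) files, as its assembly
item `Assembly` (stmt-QuantumFields-16166; route rev 10, 2026-08-16 — it supersedes
stmt-QuantumFields-9369, whose OS-legs slot was `OSLegsFromFemtoAndGap`), the implication chain

`FemtoCurvatureTwoPoint → FemtoPoincare → FemtoCurvatureSkewness → LatticeGapInUVUnits →
 OSLegsAtWeakCoupling → GapToContinuum → YangMills`.

This is *verbatim* the type of the route's deciding theorem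
`Summit.QuantumFields.YangMills.Theses.LangevinControlUV.closes` (planner-authored, sorry-free,
kernel-checked with the route file): fix `G` compact simple; `IsCompactSimpleLieGroup G` supplies a
faithful unitary lattice representation `r`; `FemtoCurvatureTwoPoint` gives the unit map `a` with its
femto two-point package; `FemtoCurvatureSkewness` and `LatticeGapInUVUnits` (both stated for every
`a` carrying that package) give the skewness witness and the infrared clustering in the same units;
`OSLegsAtWeakCoupling` returns the scheme `sch` in units `a` together with
`sch.HasWeakCouplingLimit` (`β_k → +∞`, the conjunct `def YangMills` gained on 2026-08-16, produced
inside the witness), the OS data `T`, `IsYangMillsFor r sch T`, non-triviality, non-Gaussianity and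
`HasLatticeMassGap r sch Δ`; `GapToContinuum` upgrades the latter to `T.HasMassGap Δ` — the body of
`YangMills` for `G`. `FemtoPoincare` is logically idle in the implication (engine-internal crux kept
in the chain by the planner). This file closes the item by that definitional unfolding; it adds no
mathematics of its own. The theorem below is byte-identical to the one landed for stmt-9369: its
type is the route decl `Assembly` by name, so it re-elaborates unchanged against the restated body.

Sources: route-internal (the deciding theorem `closes`); Jaffe–Witten 2000 for the axioms packaged
in `YangMills`; Barashkov–Gubinelli 2020 for the engine the cruxes describe.
Deliberately NOT here: any of the cruxes (`FemtoCurvatureTwoPoint`, `FemtoPoincare`,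
`FemtoCurvatureSkewness`, `LatticeGapInUVUnits`, `OSLegsAtWeakCoupling`, `GapToContinuum`) — they
stay open items of the route.
-/

namespace Summit.QuantumFields.YangMills.Theorems

/-- **`LangevinControlUV.Assembly` holds** (assembly item stmt-QuantumFields-16166, superseding
stmt-QuantumFields-9369): the chain
`FemtoCurvatureTwoPoint → FemtoPoincare → FemtoCurvatureSkewness → LatticeGapInUVUnits →
OSLegsAtWeakCoupling → GapToContinuum → YangMills`.
Proof: after unfolding, the goal is literally the type of the route's sorry-free deciding theorem
`LangevinControlUV.closes`. [folklore] -/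
theorem langevinControlUV_assembly_proof :
    Summit.QuantumFields.YangMills.Theses.LangevinControlUV.Assembly := by
  unfold Summit.QuantumFields.YangMills.Theses.LangevinControlUV.Assembly
  exact Summit.QuantumFields.YangMills.Theses.LangevinControlUV.closes

end Summit.QuantumFields.YangMills.Theorems

/-!
## Addendum — repair C′ (assembly item stmt-QuantumFields-16284, route rev 15, 2026-08-16)

The route re-pointed its deciding theorem `closes` and the assembly item at the chain through the
four C-items stated in CONTINUOUS intrinsic units,

`FemtoCurvatureTwoPointC → FemtoCurvatureSkewnessC → LatticeGapInUVUnitsC → OSLegsAtWeakCouplingC →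
 GapToContinuum → YangMills`,

which supersedes the chain through the typed `∀ a` items recorded in the docstrings above
(stmt-QuantumFields-16166 / stmt-QuantumFields-9369; `FemtoPoincare` is no longer in the chain).
`Assembly` is again *verbatim* the type of `closes`: fix `G` compact simple;
`IsCompactSimpleLieGroup G` supplies a faithful unitary `r`; `FemtoCurvatureTwoPointC` at `(G, r)` is
exactly the antecedent of `FemtoCurvatureSkewnessC`, which returns ONE continuous unit map `a`
carrying the two-point package and the skewness witness; `LatticeGapInUVUnitsC` and
`OSLegsAtWeakCouplingC` are evaluated at that `a`; `GapToContinuum` upgrades the lattice gap to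
`T.HasMassGap Δ`. The theorem `langevinControlUV_assembly_proof` above never names a crux, so it
re-elaborates unchanged; the alias below records the item it now closes.
-/

namespace Summit.QuantumFields.YangMills.Theorems

/-- **`LangevinControlUV.Assembly` holds** (assembly item stmt-QuantumFields-16284, repair C′):
the chain `FemtoCurvatureTwoPointC → FemtoCurvatureSkewnessC → LatticeGapInUVUnitsC →
OSLegsAtWeakCouplingC → GapToContinuum → YangMills`. Proof: after unfolding, the goal is literally
the type of the route's sorry-free deciding theorem `LangevinControlUV.closes`. [folklore] -/
theorem langevinControlUV_assemblyC_proof :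
    Summit.QuantumFields.YangMills.Theses.LangevinControlUV.Assembly := by
  unfold Summit.QuantumFields.YangMills.Theses.LangevinControlUV.Assembly
  exact Summit.QuantumFields.YangMills.Theses.LangevinControlUV.closes

end Summit.QuantumFields.YangMills.Theorems
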